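import Summits.AtomisticToContinuum.Crystallization.Theses.NashClassCertificates
import Summits.AtomisticToContinuum.Crystallization.Theses.SpectralChargeLedger

/-!
# Birth skeleton — crux `NashClassCertificates.PeriodicGivenLayered` (stmt-AtomisticToContinuum-17658)

Route `route-AtomisticToContinuum-NashClassCertificates` (rank-4 crux; shared item, also wanted by
`route-AtomisticToContinuum-SpectralChargeLedger`), sub-problem `Crystallization`; crux workfile
`Cruxes/PeriodicGivenLayered/Lines/birth.lean` (BC3 skeleton, registered with `ledger skeleton check`).

The crux (FIXED — the route's decl and signature, verbatim the shared item stmt-11779 =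
`HullMinimality.PeriodicGivenLayered` = `PhononSlackCertificates.PeriodicGivenLayered`): for every sequence
`x` of Lennard-Jones ground states in `ℝ³`, LAYERED WINDOWS at every scale (one in-layer spacing
`a ∈ [47/50, 1]`; per window a rigid motion `A`, a translation `t`, a FREE Hägg word `s` and FREE interlayer
heights `z` with increments in `[39a/50, 17a/20]`) imply PERIODIC WINDOWS at every scale (ONE periodic
configuration `P`, translations only).  The twin stmt-11779 is PROVED in tree
(`Theorems.LayeredHull.PeriodicGivenLayered_of`, module `Theorems/PhononSlackCertificatesPeriodicGivenLayered`);
that module is deliberately NOT imported by the two route files (its import cone carries the declared-only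
ERH conjectures of `Literature/NumberTheory/LFunctions/DedekindZeta.lean`), which is why the item is still an
open hypothesis of both `closes` theorems and why this skeleton is registered.

## The line (`birth` = the recurrent-limit density closing of the proved twin, cut into its four
## mathematically distinct steps; every stub is the statement of a LANDED theorem or a closed form of one)

* `stub_extraction` — COMPACTNESS (no hypothesis on `x`, potential-free): windows with per-window data
  `(A, t, s, z)` at every scale ⇒ ONE exactly layered set `A(S(a,s,z))` in the hull of `x` (two-way matched on
  every ball by translates of `x N`, frequently in `N`).  [= `LayeredHull.stub_extraction`, landed; size L]
* `stub_recurrence` — SYMBOLIC DYNAMICS (no hypothesis on `x`): a layered set in the hull ⇒ a layered set in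
  the hull with the same `a`, `A` and UNIFORMLY RECURRENT data `(s', Δz')` (minimal subset of the shift-orbit
  closure; the hull is closed under translations and local limits).  [= `LayeredHull.stub_recurrence`; L]
* `stub_closing` — DENSITY CLOSING, the load-bearing ENERGETIC step and the only place the ground-state
  hypothesis enters: a uniformly recurrent layered set in the hull of a sequence of Lennard-Jones GROUND
  STATES has no stacking fault (`s (m+1) = -s m`) and constant increments.  This is the CLOSED form of the
  landed `LayeredHull.stub_closing` (its five analytic inputs — window bounds (U)/(L), LJ registry sign +
  corner gap, increment convexity, layer cake — are landed theorems `stub_windowBounds`, `stub_registry`,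
  `stub_convexity`, `stub_layerCake` of the same namespace and are discharged inside the stub's proof, not
  carried as hypotheses here).  [XL; hardest stub]
* `stub_readoff` — ALGEBRA: a fault-free layered set with heights in arithmetic progression is the point
  set of a `PeriodicConfiguration 3` (rotated translate of a period-2 Barlow stacking).
  [= `LayeredHull.pgl_readoff`; M]

DISPROOF USED (`Cruxes/PeriodicGivenLayered/Disproof.lean`; landed
`Theorems/PeriodicGivenLayered/Negative/SpacingFreedom.lean`): the skeleton honours
`periodicGivenLayered_false_without_groundState` (free spacings `z` are fatal without energetics) and
`periodicGivenLayered_false_without_groundState_constSpacing` (the free Hägg word `s` is fatal without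
energetics): BOTH freedoms are pinned in `stub_closing`, which keeps `H = IsGroundState lennardJones` on the
sequence `x`; the potential-free stubs `stub_extraction` / `stub_recurrence` only touch the harmless
freedoms `A`, `t` (the disprover's load-bearing map).  No stub is an instance of a landed Negative lemma.

Composition: `body_of_stubs : stub-sigs → (body of the crux, verbatim)` is the explicit implication
(sorry-free); `PeriodicGivenLayered_of : NashClassCertificates.PeriodicGivenLayered` concludes the route decl
BY NAME from the four stubs (no hypotheses; `sorry` only inside `stub_*`), and
`PeriodicGivenLayered_of_spectral` the `SpectralChargeLedger` copy of the shared item.  The hypothesis form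
`stub-sigs → PeriodicGivenLayered` is `body_of_stubs` itself (its conclusion is the crux body verbatim, i.e.
`NashClassCertificates.PeriodicGivenLayered` unfolded — kept unfolded on purpose: `#h21_check_skeleton` takes the
first declaration concluding the crux BY NAME and admits no inlined `Prop` binders).
Registered signatures are fully qualified (no local notation, no `open`).
-/

noncomputable section

namespace Summit.AtomisticToContinuum.Crystallization.Cruxes.PeriodicGivenLayered.Birth

/-! ## The four registered stubs -/

/-- **Stub 1 (extraction; compactness, potential-free).** If, for every `R` and `ε > 0`, frequently in `N`, a
translate of `x N` is two-way `ε`-matched on `‖·‖ ≤ R` with SOME layered set (rigid motion `A`, Hägg word `s`,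
heights `z` in the box, all depending on the window), then ONE layered set `A(S(a,s,z))` is matched at every
scale, frequently in `N`.  Verbatim `LayeredHull.stub_extraction` (landed). [folklore] -/
theorem stub_extraction : ∀ (x : (N : ℕ) → (Fin N → EuclideanSpace ℝ (Fin 3))) (a : ℝ), 47 / 50 ≤ a → a ≤ 1 → (∀ R ε : ℝ, 0 < ε → ∃ᶠ N in Filter.atTop, ∃ (A : EuclideanSpace ℝ (Fin 3) →ₗᵢ[ℝ] EuclideanSpace ℝ (Fin 3)) (t : EuclideanSpace ℝ (Fin 3)) (s : ℤ → ℤ) (z : ℤ → ℝ), Literature.MathematicalPhysics.StatisticalMechanics.IsHaggSeq s ∧ (∀ m : ℤ, 39 / 50 * a ≤ z (m + 1) - z m ∧ z (m + 1) - z m ≤ 17 / 20 * a) ∧ let S : Set (EuclideanSpace ℝ (Fin 3)) := {p | ∃ m i j : ℤ, p = A (((i : ℝ) • Literature.MathematicalPhysics.StatisticalMechanics.triangularVec₁ a) + ((j : ℝ) • Literature.MathematicalPhysics.StatisticalMechanics.triangularVec₂ a) + ((Literature.MathematicalPhysics.StatisticalMechanics.haggLabel s m : ℝ) • Literature.MathematicalPhysics.StatisticalMechanics.barlowOffset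 a) + (z m • Literature.MathematicalPhysics.StatisticalMechanics.layerNormal 1))}; (∀ p ∈ S, ‖p‖ ≤ R → ∃ i : Fin N, dist (x N i + t) p ≤ ε) ∧ (∀ i : Fin N, ‖x N i + t‖ ≤ R → ∃ p ∈ S, dist (x N i + t) p ≤ ε)) → ∃ (A : EuclideanSpace ℝ (Fin 3) →ₗᵢ[ℝ] EuclideanSpace ℝ (Fin 3)) (s : ℤ → ℤ) (z : ℤ → ℝ), Literature.MathematicalPhysics.StatisticalMechanics.IsHaggSeq s ∧ (∀ m : ℤ, 39 / 50 * a ≤ z (m + 1) - z m ∧ z (m + 1) - z m ≤ 17 / 20 * a) ∧ let S : Set (EuclideanSpace ℝ (Fin 3)) := {p | ∃ m i j : ℤ, p = A (((i : ℝ) • Literature.MathematicalPhysics.StatisticalMechanics.triangularVec₁ a) + ((j : ℝ) • Literature.MathematicalPhysics.StatisticalMechanics.triangularVec₂ a) + ((Literature.MathematicalPhysics.StatisticalMechanics.haggLabel s m : ℝ) • Literature.MathematicalPhysics.StatisticalMechanics.barlowOffset a) + (z m • Literature.MathematicalPhysics.StatisticalMechanics.layerNormal 1))}; ∀ R ε :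 ℝ, 0 < ε → ∃ᶠ N in Filter.atTop, ∃ t : EuclideanSpace ℝ (Fin 3), (∀ p ∈ S, ‖p‖ ≤ R → ∃ i : Fin N, dist (x N i + t) p ≤ ε) ∧ (∀ i : Fin N, ‖x N i + t‖ ≤ R → ∃ p ∈ S, dist (x N i + t) p ≤ ε) := by
  sorry

/-- **Stub 2 (recurrence; symbolic dynamics, potential-free).** If a layered set `A(S(a,s,z))` is in the hull of
`x`, then so is a layered set `A(S(a,s',z'))` with the same `a`, `A`, heights in the box, whose data are UNIFORMLY
RECURRENT: every finite pattern of `(s', Δz')` that occurs once occurs, up to `η` in the increments, within a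
bounded gap of every position.  Verbatim `LayeredHull.stub_recurrence` (landed). [folklore] -/
theorem stub_recurrence : ∀ (x : (N : ℕ) → (Fin N → EuclideanSpace ℝ (Fin 3))) (a : ℝ), 47 / 50 ≤ a → a ≤ 1 → ∀ (A : EuclideanSpace ℝ (Fin 3) →ₗᵢ[ℝ] EuclideanSpace ℝ (Fin 3)) (s : ℤ → ℤ) (z : ℤ → ℝ), Literature.MathematicalPhysics.StatisticalMechanics.IsHaggSeq s → (∀ m : ℤ, 39 / 50 * a ≤ z (m + 1) - z m ∧ z (m + 1) - z m ≤ 17 / 20 * a) → (let S : Set (EuclideanSpace ℝ (Fin 3)) := {p | ∃ m i j : ℤ, p = A (((i : ℝ) • Literature.MathematicalPhysics.StatisticalMechanics.triangularVec₁ a) + ((j : ℝ) • Literature.MathematicalPhysics.StatisticalMechanics.triangularVec₂ a) + ((Literature.MathematicalPhysics.StatisticalMechanics.haggLabel s m : ℝ) • Literature.MathematicalPhysics.StatisticalMechanics.barlowOffset a) + (z m • Literature.MathematicalPhysics.StatisticalMechanics.layerNormal 1))}; ∀ R ε : ℝ, 0 < ε → ∃ᶠ N in Filter.atTop, ∃ t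 : EuclideanSpace ℝ (Fin 3), (∀ p ∈ S, ‖p‖ ≤ R → ∃ i : Fin N, dist (x N i + t) p ≤ ε) ∧ (∀ i : Fin N, ‖x N i + t‖ ≤ R → ∃ p ∈ S, dist (x N i + t) p ≤ ε)) → ∃ (s' : ℤ → ℤ) (z' : ℤ → ℝ), Literature.MathematicalPhysics.StatisticalMechanics.IsHaggSeq s' ∧ (∀ m : ℤ, 39 / 50 * a ≤ z' (m + 1) - z' m ∧ z' (m + 1) - z' m ≤ 17 / 20 * a) ∧ (∀ (n : ℕ) (η : ℝ), 0 < η → ∀ m₀ : ℤ, ∃ G : ℕ, ∀ m : ℤ, ∃ g : ℤ, 0 ≤ g ∧ g ≤ G ∧ ∀ k : ℕ, k < n → s' (m + g + k) = s' (m₀ + k) ∧ |(z' (m + g + k + 1) - z' (m + g + k)) - (z' (m₀ + k + 1) - z' (m₀ + k))| ≤ η) ∧ let S : Set (EuclideanSpace ℝ (Fin 3)) := {p | ∃ m i j : ℤ, p = A (((i : ℝ) • Literature.MathematicalPhysics.StatisticalMechanics.triangularVec₁ a) + ((j : ℝ) • Literature.MathematicalPhysics.StatisticalMechanics.triangularVec₂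 a) + ((Literature.MathematicalPhysics.StatisticalMechanics.haggLabel s' m : ℝ) • Literature.MathematicalPhysics.StatisticalMechanics.barlowOffset a) + (z' m • Literature.MathematicalPhysics.StatisticalMechanics.layerNormal 1))}; ∀ R ε : ℝ, 0 < ε → ∃ᶠ N in Filter.atTop, ∃ t : EuclideanSpace ℝ (Fin 3), (∀ p ∈ S, ‖p‖ ≤ R → ∃ i : Fin N, dist (x N i + t) p ≤ ε) ∧ (∀ i : Fin N, ‖x N i + t‖ ≤ R → ∃ p ∈ S, dist (x N i + t) p ≤ ε) := by
  sorry

/-- **Stub 3 (density closing; the energetic heart — the only stub using the ground-state hypothesis).** A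
layered set `A(S(a,s,z))` with UNIFORMLY RECURRENT data in the hull of a sequence of Lennard-Jones GROUND STATES
has no stacking fault (`s (m+1) = -s m`) and constant increments (`z (m+2) - z (m+1) = z (m+1) - z m`).  Closed
form of the landed `LayeredHull.stub_closing`: a recurring fault, resp. increment oscillation, has positive
density; on prisms its price (registry corner gap + alternating majorisation, resp. increment convexity +
Jensen) is linear in the volume, while the two-sided window bounds of hull sets at equal cardinality differ by a
boundary term only.  Honours `periodicGivenLayered_false_without_groundState` and
`…_without_groundState_constSpacing` (both freedoms `z`, `s` are pinned HERE, by energy). [folklore] -/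
theorem stub_closing : ∀ (x : (N : ℕ) → (Fin N → EuclideanSpace ℝ (Fin 3))), (∀ N, Literature.MathematicalPhysics.StatisticalMechanics.IsGroundState Literature.MathematicalPhysics.StatisticalMechanics.lennardJones (x N)) → ∀ (a : ℝ), 47 / 50 ≤ a → a ≤ 1 → ∀ (A : EuclideanSpace ℝ (Fin 3) →ₗᵢ[ℝ] EuclideanSpace ℝ (Fin 3)) (s : ℤ → ℤ) (z : ℤ → ℝ), Literature.MathematicalPhysics.StatisticalMechanics.IsHaggSeq s → (∀ m : ℤ, 39 / 50 * a ≤ z (m + 1) - z m ∧ z (m + 1) - z m ≤ 17 / 20 * a) → (∀ (n : ℕ) (η : ℝ), 0 < η → ∀ m₀ : ℤ, ∃ G : ℕ, ∀ m : ℤ, ∃ g : ℤ, 0 ≤ g ∧ g ≤ G ∧ ∀ k : ℕ, k < n → s (m + g + k) = s (m₀ + k) ∧ |(z (m + g + k + 1) - z (m + g + k)) - (z (m₀ + k + 1) - z (m₀ + k))| ≤ η) → (let S : Set (EuclideanSpace ℝ (Fin 3)) := {p | ∃ m i j : ℤ, p = A (((i : ℝ) • Literature.MathematicalPhysics.StatisticalMechanics.triangularVec₁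 a) + ((j : ℝ) • Literature.MathematicalPhysics.StatisticalMechanics.triangularVec₂ a) + ((Literature.MathematicalPhysics.StatisticalMechanics.haggLabel s m : ℝ) • Literature.MathematicalPhysics.StatisticalMechanics.barlowOffset a) + (z m • Literature.MathematicalPhysics.StatisticalMechanics.layerNormal 1))}; ∀ R ε : ℝ, 0 < ε → ∃ᶠ N in Filter.atTop, ∃ t : EuclideanSpace ℝ (Fin 3), (∀ p ∈ S, ‖p‖ ≤ R → ∃ i : Fin N, dist (x N i + t) p ≤ ε) ∧ (∀ i : Fin N, ‖x N i + t‖ ≤ R → ∃ p ∈ S, dist (x N i + t) p ≤ ε)) → (∀ m : ℤ, s (m + 1) = -s m) ∧ (∀ m : ℤ, z (m + 2) - z (m + 1) = z (m + 1) - z m) := by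
  sorry

/-- **Stub 4 (read-off; algebra).** If the Hägg word has no fault (`s (m+1) = -s m`, hence period `2`) and the
heights are in arithmetic progression with increments in the box, the layered set `A(S(a,s,z))` is the point set
of a periodic configuration (the isometric image under `A` of a translate of the period-2 Barlow configuration).
Verbatim `LayeredHull.pgl_readoff` (landed). [folklore] -/
theorem stub_readoff : ∀ (a : ℝ), 47 / 50 ≤ a → ∀ (A : EuclideanSpace ℝ (Fin 3) →ₗᵢ[ℝ] EuclideanSpace ℝ (Fin 3)) (s : ℤ → ℤ) (z : ℤ → ℝ), (∀ m : ℤ, 39 / 50 * a ≤ z (m + 1) - z m ∧ z (m + 1) - z m ≤ 17 / 20 * a) → (∀ m : ℤ, s (m + 1) = -s m) → (∀ m : ℤ, z (m + 2) - z (m + 1) = z (m + 1) - z m) → ∃ P : Literature.MathematicalPhysics.StatisticalMechanics.PeriodicConfiguration 3, P.points = {p | ∃ m i j : ℤ, p = A (((i : ℝ) • Literature.MathematicalPhysics.StatisticalMechanics.triangularVec₁ a) + ((j : ℝ) • Literature.MathematicalPhysics.StatisticalMechanics.triangularVec₂ a) + ((Literature.MathematicalPhysics.StatisticalMechanics.haggLabel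 s m : ℝ) • Literature.MathematicalPhysics.StatisticalMechanics.barlowOffset a) + (z m • Literature.MathematicalPhysics.StatisticalMechanics.layerNormal 1))} := by
  sorry

/-! ## Composition (sorry-free) -/

open Literature.MathematicalPhysics.StatisticalMechanics in
/-- **The four stub STATEMENTS imply the BODY of the crux, verbatim** (explicit implication; pure logic:
extract one layered set in the hull, make it uniformly recurrent, close it by energy, read off `P`; being in the
hull is literally the crux's conclusion).  Sorry-free. -/
theorem body_of_stubs
    (hE : ∀ (x : (N : ℕ) → (Fin N → EuclideanSpace ℝ (Fin 3))) (a : ℝ), 47 / 50 ≤ a → a ≤ 1 → (∀ R ε : ℝ, 0 < ε → ∃ᶠ N in Filter.atTop, ∃ (A : EuclideanSpace ℝ (Fin 3) →ₗᵢ[ℝ] EuclideanSpace ℝ (Fin 3)) (t : EuclideanSpace ℝ (Fin 3)) (s : ℤ → ℤ) (z : ℤ → ℝ), IsHaggSeq s ∧ (∀ m : ℤ, 39 / 50 * a ≤ z (m + 1) - z m ∧ z (m + 1) - z m ≤ 17 / 20 * a) ∧ let S : Set (EuclideanSpace ℝ (Fin 3)) := {p | ∃ m i j : ℤ, p = A (((i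 : ℝ) • triangularVec₁ a) + ((j : ℝ) • triangularVec₂ a) + ((haggLabel s m : ℝ) • barlowOffset a) + (z m • layerNormal 1))}; (∀ p ∈ S, ‖p‖ ≤ R → ∃ i : Fin N, dist (x N i + t) p ≤ ε) ∧ (∀ i : Fin N, ‖x N i + t‖ ≤ R → ∃ p ∈ S, dist (x N i + t) p ≤ ε)) → ∃ (A : EuclideanSpace ℝ (Fin 3) →ₗᵢ[ℝ] EuclideanSpace ℝ (Fin 3)) (s : ℤ → ℤ) (z : ℤ → ℝ), IsHaggSeq s ∧ (∀ m : ℤ, 39 / 50 * a ≤ z (m + 1) - z m ∧ z (m + 1) - z m ≤ 17 / 20 * a) ∧ let S : Set (EuclideanSpace ℝ (Fin 3)) := {p | ∃ m i j : ℤ, p = A (((i : ℝ) • triangularVec₁ a) + ((j : ℝ) • triangularVec₂ a) + ((haggLabel s m : ℝ) • barlowOffset a) + (z m • layerNormal 1))}; ∀ R ε : ℝ, 0 < ε → ∃ᶠ N in Filter.atTop, ∃ t : EuclideanSpace ℝ (Fin 3), (∀ p ∈ S, ‖p‖ ≤ R → ∃ i : Fin N, dist (x N i + t) p ≤ ε)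 ∧ (∀ i : Fin N, ‖x N i + t‖ ≤ R → ∃ p ∈ S, dist (x N i + t) p ≤ ε))
    (hR : ∀ (x : (N : ℕ) → (Fin N → EuclideanSpace ℝ (Fin 3))) (a : ℝ), 47 / 50 ≤ a → a ≤ 1 → ∀ (A : EuclideanSpace ℝ (Fin 3) →ₗᵢ[ℝ] EuclideanSpace ℝ (Fin 3)) (s : ℤ → ℤ) (z : ℤ → ℝ), IsHaggSeq s → (∀ m : ℤ, 39 / 50 * a ≤ z (m + 1) - z m ∧ z (m + 1) - z m ≤ 17 / 20 * a) → (let S : Set (EuclideanSpace ℝ (Fin 3)) := {p | ∃ m i j : ℤ, p = A (((i : ℝ) • triangularVec₁ a) + ((j : ℝ) • triangularVec₂ a) + ((haggLabel s m : ℝ) • barlowOffset a) + (z m • layerNormal 1))}; ∀ R ε : ℝ, 0 < ε → ∃ᶠ N in Filter.atTop, ∃ t : EuclideanSpace ℝ (Fin 3), (∀ p ∈ S, ‖p‖ ≤ R → ∃ i : Fin N, dist (x N i + t) p ≤ ε) ∧ (∀ i : Fin N, ‖x N i + t‖ ≤ R → ∃ p ∈ S, dist (x N i + t) p ≤ ε))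 → ∃ (s' : ℤ → ℤ) (z' : ℤ → ℝ), IsHaggSeq s' ∧ (∀ m : ℤ, 39 / 50 * a ≤ z' (m + 1) - z' m ∧ z' (m + 1) - z' m ≤ 17 / 20 * a) ∧ (∀ (n : ℕ) (η : ℝ), 0 < η → ∀ m₀ : ℤ, ∃ G : ℕ, ∀ m : ℤ, ∃ g : ℤ, 0 ≤ g ∧ g ≤ G ∧ ∀ k : ℕ, k < n → s' (m + g + k) = s' (m₀ + k) ∧ |(z' (m + g + k + 1) - z' (m + g + k)) - (z' (m₀ + k + 1) - z' (m₀ + k))| ≤ η) ∧ let S : Set (EuclideanSpace ℝ (Fin 3)) := {p | ∃ m i j : ℤ, p = A (((i : ℝ) • triangularVec₁ a) + ((j : ℝ) • triangularVec₂ a) + ((haggLabel s' m : ℝ) • barlowOffset a) + (z' m • layerNormal 1))}; ∀ R ε : ℝ, 0 < ε → ∃ᶠ N in Filter.atTop, ∃ t : EuclideanSpace ℝ (Fin 3), (∀ p ∈ S, ‖p‖ ≤ R → ∃ i : Fin N, dist (x N i + t) p ≤ ε) ∧ (∀ i : Fin N, ‖x N i + t‖ ≤ R → ∃ p ∈ S,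 dist (x N i + t) p ≤ ε))
    (hC : ∀ (x : (N : ℕ) → (Fin N → EuclideanSpace ℝ (Fin 3))), (∀ N, IsGroundState lennardJones (x N)) → ∀ (a : ℝ), 47 / 50 ≤ a → a ≤ 1 → ∀ (A : EuclideanSpace ℝ (Fin 3) →ₗᵢ[ℝ] EuclideanSpace ℝ (Fin 3)) (s : ℤ → ℤ) (z : ℤ → ℝ), IsHaggSeq s → (∀ m : ℤ, 39 / 50 * a ≤ z (m + 1) - z m ∧ z (m + 1) - z m ≤ 17 / 20 * a) → (∀ (n : ℕ) (η : ℝ), 0 < η → ∀ m₀ : ℤ, ∃ G : ℕ, ∀ m : ℤ, ∃ g : ℤ, 0 ≤ g ∧ g ≤ G ∧ ∀ k : ℕ, k < n → s (m + g + k) = s (m₀ + k) ∧ |(z (m + g + k + 1) - z (m + g + k)) - (z (m₀ + k + 1) - z (m₀ + k))| ≤ η) → (let S : Set (EuclideanSpace ℝ (Fin 3)) := {p | ∃ m i j : ℤ, p = A (((i : ℝ) • triangularVec₁ a) + ((j : ℝ) • triangularVec₂ a) + ((haggLabel s m : ℝ) • barlowOffset a) + (z m • layerNormal 1))}; ∀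 R ε : ℝ, 0 < ε → ∃ᶠ N in Filter.atTop, ∃ t : EuclideanSpace ℝ (Fin 3), (∀ p ∈ S, ‖p‖ ≤ R → ∃ i : Fin N, dist (x N i + t) p ≤ ε) ∧ (∀ i : Fin N, ‖x N i + t‖ ≤ R → ∃ p ∈ S, dist (x N i + t) p ≤ ε)) → (∀ m : ℤ, s (m + 1) = -s m) ∧ (∀ m : ℤ, z (m + 2) - z (m + 1) = z (m + 1) - z m))
    (hO : ∀ (a : ℝ), 47 / 50 ≤ a → ∀ (A : EuclideanSpace ℝ (Fin 3) →ₗᵢ[ℝ] EuclideanSpace ℝ (Fin 3)) (s : ℤ → ℤ) (z : ℤ → ℝ), (∀ m : ℤ, 39 / 50 * a ≤ z (m + 1) - z m ∧ z (m + 1) - z m ≤ 17 / 20 * a) → (∀ m : ℤ, s (m + 1) = -s m) → (∀ m : ℤ, z (m + 2) - z (m + 1) = z (m + 1) - z m) → ∃ P : PeriodicConfiguration 3, P.points = {p | ∃ m i j : ℤ, p = A (((i : ℝ) • triangularVec₁ a) + ((j : ℝ) • triangularVec₂ a) + ((haggLabel s m : ℝ) • barlowOffset a) + (z m • layerNormal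 1))}) :
    ∀ x : (N : ℕ) → (Fin N → EuclideanSpace ℝ (Fin 3)), (∀ N, IsGroundState lennardJones (x N)) → (∃ a : ℝ, 47 / 50 ≤ a ∧ a ≤ 1 ∧ ∀ R ε : ℝ, 0 < ε → ∃ᶠ N in Filter.atTop, ∃ (A : EuclideanSpace ℝ (Fin 3) →ₗᵢ[ℝ] EuclideanSpace ℝ (Fin 3)) (t : EuclideanSpace ℝ (Fin 3)) (s : ℤ → ℤ) (z : ℤ → ℝ), IsHaggSeq s ∧ (∀ m : ℤ, 39 / 50 * a ≤ z (m + 1) - z m ∧ z (m + 1) - z m ≤ 17 / 20 * a) ∧ let S : Set (EuclideanSpace ℝ (Fin 3)) := {p | ∃ m i j : ℤ, p = A (((i : ℝ) • triangularVec₁ a) + ((j : ℝ) • triangularVec₂ a) + ((haggLabel s m : ℝ) • barlowOffset a) + (z m • layerNormal 1))}; (∀ p ∈ S, ‖p‖ ≤ R → ∃ i : Fin N, dist (x N i + t) p ≤ ε) ∧ (∀ i : Fin N, ‖x N i + t‖ ≤ R → ∃ p ∈ S, dist (x N i + t) p ≤ ε)) → ∃ P : PeriodicConfiguration 3, ∀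 R ε : ℝ, 0 < ε → ∃ᶠ N in Filter.atTop, ∃ t : EuclideanSpace ℝ (Fin 3), (∀ s ∈ P.points, ‖s‖ ≤ R → ∃ i : Fin N, dist (x N i + t) s ≤ ε) ∧ (∀ i : Fin N, ‖x N i + t‖ ≤ R → ∃ s ∈ P.points, dist (x N i + t) s ≤ ε) := by
  intro x hx hlay
  obtain ⟨a, ha, ha1, hW⟩ := hlay
  -- (1) one exactly layered set in the hull of `x`
  obtain ⟨A, s, z, hs, hz, hH⟩ := hE x a ha ha1 hW
  -- (2) a uniformly recurrent layered set in the hull (same `a`, `A`)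
  obtain ⟨s', z', hs', hz', hrec, hH'⟩ := hR x a ha ha1 A s z hs hz hH
  -- (3) density closing: by the ground-state energetics it is fault-free and equally spaced
  obtain ⟨hfault, hconst⟩ := hC x hx a ha ha1 A s' z' hs' hz' hrec hH'
  -- (4) read off the periodic configuration; being in the hull is the conclusion
  obtain ⟨P, hP⟩ := hO a ha A s' z' hz' hfault hconst
  refine ⟨P, ?_⟩
  rw [hP]
  exact hH'

/-- **SKELETON THEOREM — the crux BY NAME from the four registered stubs** (the only declaration of this file
concluding `NashClassCertificates.PeriodicGivenLayered`; no hypotheses; its only `sorry`s are the ones inside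
`stub_extraction`, `stub_recurrence`, `stub_closing`, `stub_readoff`). -/
theorem PeriodicGivenLayered_of :
    Summit.AtomisticToContinuum.Crystallization.Theses.NashClassCertificates.PeriodicGivenLayered :=
  body_of_stubs stub_extraction stub_recurrence stub_closing stub_readoff

/-- The same composition concluding the `SpectralChargeLedger` copy of the SHARED item stmt-17658 (identical
signature; the item's default decl for `ledger skeleton check`). -/
theorem PeriodicGivenLayered_of_spectral :
    Summit.AtomisticToContinuum.Crystallization.Theses.SpectralChargeLedger.PeriodicGivenLayered :=
  body_of_stubs stub_extraction stub_recurrence stub_closing stub_readoff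

/-! ## Sanity (sorry-free `example`s, not declarations) -/

/-- The two route copies of the shared item are the same proposition (definitionally). -/
example : Summit.AtomisticToContinuum.Crystallization.Theses.NashClassCertificates.PeriodicGivenLayered ↔
    Summit.AtomisticToContinuum.Crystallization.Theses.SpectralChargeLedger.PeriodicGivenLayered :=
  Iff.rfl

end Summit.AtomisticToContinuum.Crystallization.Cruxes.PeriodicGivenLayered.Birth

end
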